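import Mathlib
import Summits.Ventures.PercRepro2.Defs
import Summits.Ventures.PercRepro2.Independence
import Summits.Ventures.PercRepro2.Harris
import Summits.Ventures.PercRepro2.Graph
import Summits.Ventures.PercRepro2.Events
import Summits.Ventures.PercRepro2.Induced
import Summits.Ventures.PercRepro2.MixedBoxDefs
import Summits.Ventures.PercRepro2.BTVFamilyDefs
import Summits.Ventures.PercRepro2.BTVFamilyCorollary
import Summits.Ventures.PercRepro2.BlockConn
import Summits.Ventures.PercRepro2.BlockFamilyDefs
import Summits.Ventures.PercRepro2.BlockFamily

/-!
# The block family: the doubled four-vertex survivors (blind cell PercRepro2, mine-1 g53;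
paper proofs/MINE1-BLOCKS.md Corollary 2.2)

The singleton cases of `bfamily`: in the four-status law on `{s ↮ t}` (`MixedBox.status`:
`2` = in `C_s`, `0` = in `C_t`, `1` = in neither),

* `lsm_NNST_SSTN`: `m(NNST) m(SSTN) ≤ m(SSSN) m(NNTT)` in the coordinates `(u₁, u₂, v, w)` — two
  `u`-vertices (`Vs = {v}`, `A₁ = {u₁, u₂}`, blocks `{{u₁}, {u₂}}`, `W = {w}`);
* `lsm_NSST_STTN`: `m(NSST) m(STTN) ≤ m(SSSN) m(NTTT)` in `(u, v₁, v₂, w)` — two `v`-vertices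
  (`Vs = {v₁, v₂}`, `A₁ = {u}`, blocks `{{u}}`, `W = {w}`).

These are g51's two doubled four-vertex survivors of the log-supermodular-pair census
(MINE-1.md §68–§70); `LSMPair4` is the four-coordinate registry form (`lsmPair4_NNST_SSTN`,
`lsmPair4_NSST_STTN`).
-/

namespace Summit.Ventures.PercRepro2

namespace BlockFamily

open BTVFamily MixedBox

section Singletons

variable {V : Type*} {E : Type*} [DecidableEq V] {ends : E → Sym2 V} {ω : Config E}

omit [DecidableEq V] in
/-- With singleton blocks, contracted connectivity is plain connectivity. -/
lemma connB_iff_conn_of_singletons {𝒰 : Finset (Finset V)}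
    (h : ∀ B ∈ 𝒰, ∀ x ∈ B, ∀ y ∈ B, x = y) {x y : V} :
    ConnB ends ω 𝒰 x y ↔ Conn ends ω x y := by
  refine ⟨fun hc => ?_, connB_of_conn⟩
  refine connB_induction (P := fun y => Conn ends ω x y) (conn_refl _ _ _) ?_ hc
  rintro b y _ hb (hby | ⟨B, hB, hbB, hyB⟩)
  · exact conn_trans hb hby
  · rw [h B hB b hbB y hyB] at hb
    exact hb

omit [DecidableEq V] in
/-- `{x} ↔_𝒰 {y}` with singleton blocks is `x ↔ y`. -/
lemma connSetB_singleton_singleton_of_singletons {𝒰 : Finset (Finset V)}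
    (h : ∀ B ∈ 𝒰, ∀ x ∈ B, ∀ y ∈ B, x = y) {x y : V} :
    ConnSetB ends ω 𝒰 {x} {y} ↔ Conn ends ω x y := by
  rw [connSetB_singleton_left]
  simp [connB_iff_conn_of_singletons h]

/-- The blocks `{{u₁}, {u₂}}` are singletons. -/
lemma singletons_pair (u₁ u₂ : V) :
    ∀ B ∈ ({{u₁}, {u₂}} : Finset (Finset V)), ∀ x ∈ B, ∀ y ∈ B, x = y := by
  intro B hB x hx y hy
  simp only [Finset.mem_insert, Finset.mem_singleton] at hB
  rcases hB with rfl | rfl <;> simp only [Finset.mem_singleton] at hx hy <;> rw [hx, hy]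

omit [DecidableEq V] in
/-- The block `{{u}}` is a singleton. -/
lemma singletons_single (u : V) :
    ∀ B ∈ ({{u}} : Finset (Finset V)), ∀ x ∈ B, ∀ y ∈ B, x = y := by
  intro B hB x hx y hy
  simp only [Finset.mem_singleton] at hB
  subst hB
  simp only [Finset.mem_singleton] at hx hy
  rw [hx, hy]

/-- `X ↔ {x, y}` iff `X ↔ {x}` or `X ↔ {y}`. -/
lemma connSet_pair_right {X : Finset V} {x y : V} :
    ConnSet ends ω X {x, y} ↔ ConnSet ends ω X {x} ∨ ConnSet ends ω X {y} := by
  rw [Finset.insert_eq, connSet_union_right]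

/-- `{x, y} ↔ Y` iff `{x} ↔ Y` or `{y} ↔ Y`. -/
lemma connSet_pair_left {Y : Finset V} {x y : V} :
    ConnSet ends ω {x, y} Y ↔ ConnSet ends ω {x} Y ∨ ConnSet ends ω {y} Y := by
  rw [Finset.insert_eq, connSet_union_left]

/-- `⋃ {{u₁}, {u₂}} = {u₁, u₂}`. -/
lemma unionB_pair (u₁ u₂ : V) : unionB ({{u₁}, {u₂}} : Finset (Finset V)) = {u₁, u₂} := by
  ext x
  simp [mem_unionB]

/-- `⋃ {{u}} = {u}`. -/
lemma unionB_single (u : V) : unionB ({{u}} : Finset (Finset V)) = {u} := by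
  ext x
  simp [mem_unionB]

end Singletons

section FourVertex

variable {V : Type*} {E : Type*} [Fintype E] [DecidableEq E] [Fintype V] [DecidableEq V]
  {R : Type*} [CommRing R] [LinearOrder R] [IsStrictOrderedRing R]

/-- A cell of the four-status law on `{s ↮ t}`: the statuses of `x₁, x₂, x₃, x₄` relative to the
roots `s, t` are `c`, and `s ↮ t`. -/
def cell4 (ends : E → Sym2 V) (s t x₁ x₂ x₃ x₄ : V) (c : Fin 3 × Fin 3 × Fin 3 × Fin 3) :
    Set (Config E) :=
  {ω | status ends s t x₁ ω = c.1 ∧ status ends s t x₂ ω = c.2.1 ∧ status ends s t x₃ ω = c.2.2.1 ∧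
    status ends s t x₄ ω = c.2.2.2 ∧ ¬ Conn ends ω s t}

omit [DecidableEq E] in
/-- The cell `a` with `Vs = {v}`, `A = {u₁, u₂}`, `W = {w}` is `NNST`. -/
lemma aEv_pair_eq (ends : E → Sym2 V) (s t u₁ u₂ v w : V) :
    aEv ends Finset.univ s t {v} {u₁, u₂} {w} = cell4 ends s t u₁ u₂ v w (1, 1, 2, 0) := by
  ext ω
  simp only [aEv, cell4, Set.mem_setOf_eq, Finset.coe_univ, induced_univ, aProp,
    connSet_union_right, connSet_pair_right, connSet_singleton_singleton, Finset.mem_singleton,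
    forall_eq, status_eq_one_iff, status_eq_two_iff, status_eq_zero_iff, not_or]
  constructor
  · rintro ⟨h1, h2, ⟨⟨h3, h4, h5⟩, h6⟩, ⟨h7, h8⟩, h9, h10⟩
    exact ⟨⟨h4, h7⟩, ⟨h5, h8⟩, conn_symm h1, ⟨h6, h2⟩, h3⟩
  · rintro ⟨⟨h4, h7⟩, ⟨h5, h8⟩, h1, ⟨h6, h2⟩, h3⟩
    exact ⟨conn_symm h1, h2, ⟨⟨h3, h4, h5⟩, h6⟩, ⟨h7, h8⟩,
      fun h => h7 (conn_trans h2 h), fun h => h8 (conn_trans h2 h)⟩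

omit [DecidableEq E] in
/-- The cell `b` with `Vs = {v}`, blocks `{{u₁}, {u₂}}`, `W = {w}` is `SSTN`. -/
lemma bEv_pair_eq (ends : E → Sym2 V) (s t u₁ u₂ v w : V) :
    bEv ends Finset.univ s t {v} {{u₁}, {u₂}} {w} = cell4 ends s t u₁ u₂ v w (2, 2, 0, 1) := by
  ext ω
  simp only [bEv, cell4, Set.mem_setOf_eq, Finset.coe_univ, induced_univ, bProp, unionB_pair,
    Finset.forall_mem_insert, Finset.mem_singleton, forall_eq,
    connSetB_singleton_singleton_of_singletons (singletons_pair u₁ u₂),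
    connSet_union_right, connSet_pair_right, connSet_pair_left, connSet_singleton_singleton,
    status_eq_one_iff, status_eq_two_iff, status_eq_zero_iff, not_or]
  constructor
  · rintro ⟨⟨h1, h2⟩, h3, ⟨⟨h4, h5, h6⟩, h7⟩, h8, h9, h10⟩
    exact ⟨h1, h2, ⟨fun h => h4 (conn_trans (conn_symm h3) (conn_symm h)), conn_symm h3⟩,
      ⟨h8, h7⟩, fun h => h4 (conn_symm h)⟩
  · rintro ⟨h1, h2, ⟨h3, h3'⟩, ⟨h8, h7⟩, h4⟩
    exact ⟨⟨h1, h2⟩, conn_symm h3', ⟨⟨fun h => h4 (conn_symm h),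
      fun h => h4 (conn_trans h1 (conn_symm h)), fun h => h4 (conn_trans h2 (conn_symm h))⟩, h7⟩,
      h8, fun h => h8 (conn_trans h1 h), fun h => h8 (conn_trans h2 h)⟩

omit [DecidableEq E] in
/-- The cell `j` with `Vs = {v}`, frontier `{u₁, u₂}`, blocks `{{u₁}, {u₂}}`, `W = {w}` is `SSSN`. -/
lemma jEv_pair_eq (ends : E → Sym2 V) (s t u₁ u₂ v w : V) :
    jEv ends Finset.univ s t {v} {u₁, u₂} {{u₁}, {u₂}} {w} = cell4 ends s t u₁ u₂ v w (2, 2, 2, 1) := by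
  ext ω
  simp only [jEv, cell4, Set.mem_setOf_eq, Finset.coe_univ, induced_univ, jProp,
    Finset.forall_mem_insert, Finset.mem_singleton, forall_eq,
    connSetB_singleton_singleton_of_singletons (singletons_pair u₁ u₂),
    connB_iff_conn_of_singletons (singletons_pair u₁ u₂),
    connSet_union_right, connSet_union_left, connSet_pair_right, connSet_pair_left,
    connSet_singleton_singleton, status_eq_one_iff, status_eq_two_iff, not_or]
  constructor
  · rintro ⟨⟨h1, h2⟩, h3, ⟨⟨h4, h5, h6⟩, h7⟩, h8, h9, h10⟩
    exact ⟨h1, h2, conn_symm h3, ⟨h8, h7⟩, fun h => h4 (conn_symm h)⟩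
  · rintro ⟨h1, h2, h3, ⟨h8, h7⟩, h4⟩
    exact ⟨⟨h1, h2⟩, conn_symm h3, ⟨⟨fun h => h4 (conn_symm h),
      fun h => h4 (conn_trans h1 (conn_symm h)), fun h => h4 (conn_trans h2 (conn_symm h))⟩, h7⟩,
      h8, fun h => h8 (conn_trans h1 h), fun h => h8 (conn_trans h2 h)⟩

omit [DecidableEq E] in
/-- The cell `m` with `Vs = {v}`, `A = {u₁, u₂}`, `W = {w}` is `NNTT`. -/
lemma mEv_pair_eq (ends : E → Sym2 V) (s t u₁ u₂ v w : V) :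
    mEv ends Finset.univ s t {v} {u₁, u₂} {w} = cell4 ends s t u₁ u₂ v w (1, 1, 0, 0) := by
  ext ω
  simp only [mEv, cell4, Set.mem_setOf_eq, Finset.coe_univ, induced_univ, mProp,
    connSet_union_right, connSet_union_left, connSet_pair_right, connSet_singleton_singleton,
    Finset.mem_singleton, forall_eq, status_eq_one_iff, status_eq_zero_iff, not_or]
  constructor
  · rintro ⟨h1, h2, ⟨⟨h3, h4, h5⟩, h6⟩, ⟨h7, h8⟩, h9, h10⟩
    refine ⟨⟨h4, h7⟩, ⟨h5, h9⟩, ⟨?_, ?_⟩, ⟨h6, h1⟩, h3⟩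
    · rcases h2 with h2 | h2
      · exact fun h => h3 (conn_trans h h2)
      · exact fun h => h6 (conn_trans h h2)
    · rcases h2 with h2 | h2
      · exact conn_symm h2
      · exact conn_trans h1 (conn_symm h2)
  · rintro ⟨⟨h4, h7⟩, ⟨h5, h9⟩, ⟨h2, h2'⟩, ⟨h6, h1⟩, h3⟩
    exact ⟨h1, Or.inl (conn_symm h2'), ⟨⟨h3, h4, h5⟩, h6⟩, ⟨h7, fun h => h7 (conn_trans h1 h)⟩,
      h9, fun h => h9 (conn_trans h1 h)⟩

/-- **`m(NNST) m(SSTN) ≤ m(SSSN) m(NNTT)`** — the doubled (B-T) with two `u`-vertices, in the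
coordinates `(u₁, u₂, v, w)` of the four-status law on `{s ↮ t}`: for every finite graph, every
admissible weight vector and arbitrary vertices. -/
theorem lsm_NNST_SSTN (p : E → R) (hp : IsProbVec p) (ends : E → Sym2 V) (s t u₁ u₂ v w : V) :
    prob p (cell4 ends s t u₁ u₂ v w (1, 1, 2, 0)) * prob p (cell4 ends s t u₁ u₂ v w (2, 2, 0, 1)) ≤
      prob p (cell4 ends s t u₁ u₂ v w (2, 2, 2, 1)) *
        prob p (cell4 ends s t u₁ u₂ v w (1, 1, 0, 0)) := by
  have key := bfamily p hp ends s t {v} Finset.univ {u₁, u₂} {w} {{u₁}, {u₂}} {w}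
    (Finset.subset_univ _) (Finset.subset_univ _) (Finset.subset_univ _) (Finset.subset_univ _)
  rw [unionB_pair, Finset.union_self, Finset.inter_self, Finset.union_self, Finset.inter_self,
    aEv_pair_eq, bEv_pair_eq, jEv_pair_eq, mEv_pair_eq] at key
  exact key

omit [DecidableEq E] in
/-- The cell `a` with `Vs = {v₁, v₂}`, `A = {u}`, `W = {w}` is `NSST`. -/
lemma aEv_twov_eq (ends : E → Sym2 V) (s t u v₁ v₂ w : V) :
    aEv ends Finset.univ s t {v₁, v₂} {u} {w} = cell4 ends s t u v₁ v₂ w (1, 2, 2, 0) := by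
  ext ω
  simp only [aEv, cell4, Set.mem_setOf_eq, Finset.coe_univ, induced_univ, aProp,
    Finset.forall_mem_insert, Finset.mem_singleton, forall_eq, connSet_union_right,
    connSet_singleton_singleton, status_eq_one_iff, status_eq_two_iff, status_eq_zero_iff, not_or]
  constructor
  · rintro ⟨⟨h1, h1'⟩, h2, ⟨⟨h3, h4⟩, h6⟩, h7, h9⟩
    exact ⟨⟨h4, h7⟩, conn_symm h1, conn_symm h1', ⟨h6, h2⟩, h3⟩
  · rintro ⟨⟨h4, h7⟩, h1, h1', ⟨h6, h2⟩, h3⟩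
    exact ⟨⟨conn_symm h1, conn_symm h1'⟩, h2, ⟨⟨h3, h4⟩, h6⟩, h7, fun h => h7 (conn_trans h2 h)⟩

omit [DecidableEq E] in
/-- The cell `b` with `Vs = {v₁, v₂}`, blocks `{{u}}`, `W = {w}` is `STTN`. -/
lemma bEv_twov_eq (ends : E → Sym2 V) (s t u v₁ v₂ w : V) :
    bEv ends Finset.univ s t {v₁, v₂} {{u}} {w} = cell4 ends s t u v₁ v₂ w (2, 0, 0, 1) := by
  ext ω
  simp only [bEv, cell4, Set.mem_setOf_eq, Finset.coe_univ, induced_univ, bProp, unionB_single,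
    Finset.forall_mem_insert, Finset.mem_singleton, forall_eq,
    connSetB_singleton_singleton_of_singletons (singletons_single u),
    connSet_union_right, connSet_singleton_singleton,
    status_eq_one_iff, status_eq_two_iff, status_eq_zero_iff, not_or]
  constructor
  · rintro ⟨h1, ⟨h3, h3'⟩, ⟨⟨h4, h5⟩, h7⟩, h8, h9⟩
    exact ⟨h1, ⟨fun h => h4 (conn_trans (conn_symm h3) (conn_symm h)), conn_symm h3⟩,
      ⟨fun h => h4 (conn_trans (conn_symm h3') (conn_symm h)), conn_symm h3'⟩, ⟨h8, h7⟩,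
      fun h => h4 (conn_symm h)⟩
  · rintro ⟨h1, ⟨h3, h3'⟩, ⟨h5, h5'⟩, ⟨h8, h7⟩, h4⟩
    exact ⟨h1, ⟨conn_symm h3', conn_symm h5'⟩, ⟨⟨fun h => h4 (conn_symm h),
      fun h => h4 (conn_trans h1 (conn_symm h))⟩, h7⟩, h8, fun h => h8 (conn_trans h1 h)⟩

omit [DecidableEq E] in
/-- The cell `j` with `Vs = {v₁, v₂}`, frontier `{u}`, blocks `{{u}}`, `W = {w}` is `SSSN`. -/
lemma jEv_twov_eq (ends : E → Sym2 V) (s t u v₁ v₂ w : V) :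
    jEv ends Finset.univ s t {v₁, v₂} {u} {{u}} {w} = cell4 ends s t u v₁ v₂ w (2, 2, 2, 1) := by
  ext ω
  simp only [jEv, cell4, Set.mem_setOf_eq, Finset.coe_univ, induced_univ, jProp,
    Finset.forall_mem_insert, Finset.mem_singleton, forall_eq,
    connSetB_singleton_singleton_of_singletons (singletons_single u),
    connB_iff_conn_of_singletons (singletons_single u),
    connSet_union_right, connSet_union_left, connSet_singleton_singleton,
    status_eq_one_iff, status_eq_two_iff, not_or]
  constructor
  · rintro ⟨h1, ⟨h3, h3'⟩, ⟨⟨h4, h5⟩, h7⟩, h8, h9⟩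
    exact ⟨h1, conn_symm h3, conn_symm h3', ⟨h8, h7⟩, fun h => h4 (conn_symm h)⟩
  · rintro ⟨h1, h3, h3', ⟨h8, h7⟩, h4⟩
    exact ⟨h1, ⟨conn_symm h3, conn_symm h3'⟩, ⟨⟨fun h => h4 (conn_symm h),
      fun h => h4 (conn_trans h1 (conn_symm h))⟩, h7⟩, h8, fun h => h8 (conn_trans h1 h)⟩

omit [DecidableEq E] in
/-- The cell `m` with `Vs = {v₁, v₂}`, `A = {u}`, `W = {w}` is `NTTT`. -/
lemma mEv_twov_eq (ends : E → Sym2 V) (s t u v₁ v₂ w : V) :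
    mEv ends Finset.univ s t {v₁, v₂} {u} {w} = cell4 ends s t u v₁ v₂ w (1, 0, 0, 0) := by
  ext ω
  simp only [mEv, cell4, Set.mem_setOf_eq, Finset.coe_univ, induced_univ, mProp,
    Finset.forall_mem_insert, Finset.mem_singleton, forall_eq, connSet_union_right,
    connSet_union_left, connSet_singleton_singleton, status_eq_one_iff, status_eq_zero_iff, not_or]
  constructor
  · rintro ⟨h1, ⟨h2, h2'⟩, ⟨⟨h3, h4⟩, h6⟩, h7, h9⟩
    have hv : ∀ v, (Conn ends ω v t ∨ Conn ends ω v w) → ¬ Conn ends ω s v ∧ Conn ends ω t v := by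
      rintro v (hv | hv)
      · exact ⟨fun h => h3 (conn_trans h hv), conn_symm hv⟩
      · exact ⟨fun h => h6 (conn_trans h hv), conn_trans h1 (conn_symm hv)⟩
    exact ⟨⟨h4, h7⟩, hv v₁ h2, hv v₂ h2', ⟨h6, h1⟩, h3⟩
  · rintro ⟨⟨h4, h7⟩, ⟨h2, h2'⟩, ⟨h5, h5'⟩, ⟨h6, h1⟩, h3⟩
    exact ⟨h1, ⟨Or.inl (conn_symm h2'), Or.inl (conn_symm h5')⟩, ⟨⟨h3, h4⟩, h6⟩, h7,
      fun h => h7 (conn_trans h1 h)⟩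

/-- **`m(NSST) m(STTN) ≤ m(SSSN) m(NTTT)`** — the doubled (B-T) with two `v`-vertices, in the
coordinates `(u, v₁, v₂, w)` of the four-status law on `{s ↮ t}`. -/
theorem lsm_NSST_STTN (p : E → R) (hp : IsProbVec p) (ends : E → Sym2 V) (s t u v₁ v₂ w : V) :
    prob p (cell4 ends s t u v₁ v₂ w (1, 2, 2, 0)) * prob p (cell4 ends s t u v₁ v₂ w (2, 0, 0, 1)) ≤
      prob p (cell4 ends s t u v₁ v₂ w (2, 2, 2, 1)) *
        prob p (cell4 ends s t u v₁ v₂ w (1, 0, 0, 0)) := by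
  have key := bfamily p hp ends s t {v₁, v₂} Finset.univ {u} {w} {{u}} {w}
    (Finset.subset_univ _) (Finset.subset_univ _) (Finset.subset_univ _) (Finset.subset_univ _)
  rw [unionB_single, Finset.union_self, Finset.inter_self, Finset.union_self, Finset.inter_self,
    aEv_twov_eq, bEv_twov_eq, jEv_twov_eq, mEv_twov_eq] at key
  exact key

/-- The coordinatewise join of two cells of the four-status law in the order `T < N < S`
(`0 < 1 < 2`). -/
def cellJoin4 (a b : Fin 3 × Fin 3 × Fin 3 × Fin 3) : Fin 3 × Fin 3 × Fin 3 × Fin 3 :=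
  (max a.1 b.1, max a.2.1 b.2.1, max a.2.2.1 b.2.2.1, max a.2.2.2 b.2.2.2)

/-- The coordinatewise meet of two cells of the four-status law. -/
def cellMeet4 (a b : Fin 3 × Fin 3 × Fin 3 × Fin 3) : Fin 3 × Fin 3 × Fin 3 × Fin 3 :=
  (min a.1 b.1, min a.2.1 b.2.1, min a.2.2.1 b.2.2.1, min a.2.2.2 b.2.2.2)

/-- **The log-supermodular pair inequality of the four-status law** for the cells `a, b`:
`P(σ = a, s↮t) · P(σ = b, s↮t) ≤ P(σ = a∨b, s↮t) · P(σ = a∧b, s↮t)` for every finite graph,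
every admissible rational weight vector, roots `s, t` and observed vertices `x₁, x₂, x₃, x₄`
(the four-coordinate form of `LSMPair` of `LSMPairRefutation.lean`). -/
def LSMPair4 (a b : Fin 3 × Fin 3 × Fin 3 × Fin 3) : Prop :=
  ∀ (V E : Type) [Fintype V] [DecidableEq V] [Fintype E] [DecidableEq E] (p : E → ℚ),
    IsProbVec p → ∀ (ends : E → Sym2 V) (s t x₁ x₂ x₃ x₄ : V),
    prob p (cell4 ends s t x₁ x₂ x₃ x₄ a) * prob p (cell4 ends s t x₁ x₂ x₃ x₄ b) ≤
      prob p (cell4 ends s t x₁ x₂ x₃ x₄ (cellJoin4 a b)) *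
        prob p (cell4 ends s t x₁ x₂ x₃ x₄ (cellMeet4 a b))

/-- `(NNST, SSTN)` in the registry form: `LSMPair4 (1,1,2,0) (2,2,0,1)`. -/
theorem lsmPair4_NNST_SSTN : LSMPair4 (1, 1, 2, 0) (2, 2, 0, 1) := by
  intro V E _ _ _ _ p hp ends s t x₁ x₂ x₃ x₄
  have hj : cellJoin4 (1, 1, 2, 0) (2, 2, 0, 1) = (2, 2, 2, 1) := by decide
  have hm : cellMeet4 (1, 1, 2, 0) (2, 2, 0, 1) = (1, 1, 0, 0) := by decide
  rw [hj, hm]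
  exact lsm_NNST_SSTN p hp ends s t x₁ x₂ x₃ x₄

/-- `(NSST, STTN)` in the registry form: `LSMPair4 (1,2,2,0) (2,0,0,1)`. -/
theorem lsmPair4_NSST_STTN : LSMPair4 (1, 2, 2, 0) (2, 0, 0, 1) := by
  intro V E _ _ _ _ p hp ends s t x₁ x₂ x₃ x₄
  have hj : cellJoin4 (1, 2, 2, 0) (2, 0, 0, 1) = (2, 2, 2, 1) := by decide
  have hm : cellMeet4 (1, 2, 2, 0) (2, 0, 0, 1) = (1, 0, 0, 0) := by decide
  rw [hj, hm]
  exact lsm_NSST_STTN p hp ends s t x₁ x₂ x₃ x₄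

end FourVertex

end BlockFamily

end Summit.Ventures.PercRepro2
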